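import Mathlib
import HarnessLib
import Summits.ValiantsHypothesis.ValiantsHypothesis.Theorems.LacunarySymmetroidMatrixDescartesProductPlusOneRowTowerKCalculus
import Summits.ValiantsHypothesis.ValiantsHypothesis.Theorems.LacunarySymmetroidMatrixDescartesProductPlusOneRowTowerKDefs8

/-!
# LINE (A) `product_plus_one` — the θ-tower to order 8: the derivative chain `θψ_k = ψ_{k+1}` (k = 3…6)

Companion of ✓/⧗ `…RowTowerKDefs8` (`rowPsiK4…7`) and ✓ `…RowTowerKCalculus` (`hasDerivAt_rowHK`, `hasDerivAt_rowUK`, `hasDerivAt_rowPsiK1/2`):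
`hasDerivAt_rowPsiK3 … hasDerivAt_rowPsiK6` — `d/dx ψ_k = ψ_{k+1}/x` wherever the row does not vanish (`x ≠ 0`).  With these, `Λ(θ²)ψ₁` for any cubic
`Λ` is the explicit tower polynomial `ψ₇ − e₁ψ₅ + e₂ψ₃ − e₃ψ₁`, and `θ` of it is available for Rolle arguments (C5 of memo §30.7).

Honest framing: calculus of rows (helpers); nothing closes; 18050 / `MatrixDescartes` OPEN; `VP ≠ VNP` NOT proved.  No definitions, no named facts.
-/

set_option linter.dupNamespace false

namespace Summit.ValiantsHypothesis.ValiantsHypothesis.Theorems.LacunarySymmetroidMatrixDescartes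

namespace ProductPlusOne

open Finset
open scoped BigOperators

variable {n : ℕ} (lam : Fin n → ℕ) (A : ℝ) (B : Fin n → ℝ)

/-- `d/dx ψ₃ = ψ₄/x`. [this file's lemma] -/
theorem hasDerivAt_rowPsiK3 {x : ℝ} (hx : x ≠ 0) (hF : A - ∑ l, B l * x ^ (lam l) ≠ 0) :
    HasDerivAt (rowPsiK3 lam A B) (rowPsiK4 lam A B x / x) x := by
  have hH1 := hasDerivAt_rowHK lam B 1 hx
  have hH2 := hasDerivAt_rowHK lam B 2 hx
  have hH3 := hasDerivAt_rowHK lam B 3 hx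
  have hH4 := hasDerivAt_rowHK lam B 4 hx
  have hH5 := hasDerivAt_rowHK lam B 5 hx
  have hu := hasDerivAt_rowUK lam A B hx hF
  have h := ((((((hH4.mul hu).const_mul (1 : ℝ)).add (((hH2.pow 2).mul (hu.pow 2)).const_mul (3 : ℝ))).add (((hH1.mul hH3).mul (hu.pow 2)).const_mul (4 : ℝ))).add ((((hH1.pow 2).mul hH2).mul (hu.pow 3)).const_mul (12 : ℝ))).add (((hH1.pow 4).mul (hu.pow 4)).const_mul (6 : ℝ)))
  have hfun : rowPsiK3 lam A B = fun t =>
      1 * (rowHK lam 4 B t * rowUK lam A B t) +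
        3 * (rowHK lam 2 B t ^ 2 * rowUK lam A B t ^ 2) +
        4 * (rowHK lam 1 B t * rowHK lam 3 B t * rowUK lam A B t ^ 2) +
        12 * (rowHK lam 1 B t ^ 2 * rowHK lam 2 B t * rowUK lam A B t ^ 3) +
        6 * (rowHK lam 1 B t ^ 4 * rowUK lam A B t ^ 4) := by
    funext t; unfold rowPsiK3; ring
  rw [hfun]
  refine h.congr_deriv ?_
  unfold rowPsiK4
  simp only [Pi.mul_apply, Pi.pow_apply]
  push_cast
  field_simp
  ring

/-- `d/dx ψ₄ = ψ₅/x`. [this file's lemma] -/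
theorem hasDerivAt_rowPsiK4 {x : ℝ} (hx : x ≠ 0) (hF : A - ∑ l, B l * x ^ (lam l) ≠ 0) :
    HasDerivAt (rowPsiK4 lam A B) (rowPsiK5 lam A B x / x) x := by
  have hH1 := hasDerivAt_rowHK lam B 1 hx
  have hH2 := hasDerivAt_rowHK lam B 2 hx
  have hH3 := hasDerivAt_rowHK lam B 3 hx
  have hH4 := hasDerivAt_rowHK lam B 4 hx
  have hH5 := hasDerivAt_rowHK lam B 5 hx
  have hH6 := hasDerivAt_rowHK lam B 6 hx
  have hu := hasDerivAt_rowUK lam A B hx hF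
  have h := ((((((((hH5.mul hu).const_mul (1 : ℝ)).add (((hH2.mul hH3).mul (hu.pow 2)).const_mul (10 : ℝ))).add (((hH1.mul hH4).mul (hu.pow 2)).const_mul (5 : ℝ))).add (((hH1.mul (hH2.pow 2)).mul (hu.pow 3)).const_mul (30 : ℝ))).add ((((hH1.pow 2).mul hH3).mul (hu.pow 3)).const_mul (20 : ℝ))).add ((((hH1.pow 3).mul hH2).mul (hu.pow 4)).const_mul (60 : ℝ))).add (((hH1.pow 5).mul (hu.pow 5)).const_mul (24 : ℝ)))
  have hfun : rowPsiK4 lam A B = fun t =>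
      1 * (rowHK lam 5 B t * rowUK lam A B t) +
        10 * (rowHK lam 2 B t * rowHK lam 3 B t * rowUK lam A B t ^ 2) +
        5 * (rowHK lam 1 B t * rowHK lam 4 B t * rowUK lam A B t ^ 2) +
        30 * (rowHK lam 1 B t * rowHK lam 2 B t ^ 2 * rowUK lam A B t ^ 3) +
        20 * (rowHK lam 1 B t ^ 2 * rowHK lam 3 B t * rowUK lam A B t ^ 3) +
        60 * (rowHK lam 1 B t ^ 3 * rowHK lam 2 B t * rowUK lam A B t ^ 4) +
        24 * (rowHK lam 1 B t ^ 5 * rowUK lam A B t ^ 5) := by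
    funext t; unfold rowPsiK4; ring
  rw [hfun]
  refine h.congr_deriv ?_
  unfold rowPsiK5
  simp only [Pi.mul_apply, Pi.pow_apply]
  push_cast
  field_simp
  ring

/-- `d/dx ψ₅ = ψ₆/x`. [this file's lemma] -/
theorem hasDerivAt_rowPsiK5 {x : ℝ} (hx : x ≠ 0) (hF : A - ∑ l, B l * x ^ (lam l) ≠ 0) :
    HasDerivAt (rowPsiK5 lam A B) (rowPsiK6 lam A B x / x) x := by
  have hH1 := hasDerivAt_rowHK lam B 1 hx
  have hH2 := hasDerivAt_rowHK lam B 2 hx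
  have hH3 := hasDerivAt_rowHK lam B 3 hx
  have hH4 := hasDerivAt_rowHK lam B 4 hx
  have hH5 := hasDerivAt_rowHK lam B 5 hx
  have hH6 := hasDerivAt_rowHK lam B 6 hx
  have hH7 := hasDerivAt_rowHK lam B 7 hx
  have hu := hasDerivAt_rowUK lam A B hx hF
  have h := ((((((((((((hH6.mul hu).const_mul (1 : ℝ)).add (((hH3.pow 2).mul (hu.pow 2)).const_mul (10 : ℝ))).add (((hH2.mul hH4).mul (hu.pow 2)).const_mul (15 : ℝ))).add (((hH1.mul hH5).mul (hu.pow 2)).const_mul (6 : ℝ))).add (((hH2.pow 3).mul (hu.pow 3)).const_mul (30 : ℝ))).add ((((hH1.mul hH2).mul hH3).mul (hu.pow 3)).const_mul (120 : ℝ))).add ((((hH1.pow 2).mul hH4).mul (hu.pow 3)).const_mul (30 : ℝ))).add ((((hH1.pow 2).mul (hH2.pow 2)).mul (hu.pow 4)).const_mul (270 : ℝ))).add ((((hH1.pow 3).mul hH3).mul (hu.pow 4)).const_mul (120 : ℝ))).add ((((hH1.pow 4).mul hH2).mul (hu.pow 5)).const_mul (360 : ℝ))).add (((hH1.pow 6).mul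 (hu.pow 6)).const_mul (120 : ℝ)))
  have hfun : rowPsiK5 lam A B = fun t =>
      1 * (rowHK lam 6 B t * rowUK lam A B t) +
        10 * (rowHK lam 3 B t ^ 2 * rowUK lam A B t ^ 2) +
        15 * (rowHK lam 2 B t * rowHK lam 4 B t * rowUK lam A B t ^ 2) +
        6 * (rowHK lam 1 B t * rowHK lam 5 B t * rowUK lam A B t ^ 2) +
        30 * (rowHK lam 2 B t ^ 3 * rowUK lam A B t ^ 3) +
        120 * (rowHK lam 1 B t * rowHK lam 2 B t * rowHK lam 3 B t * rowUK lam A B t ^ 3) +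
        30 * (rowHK lam 1 B t ^ 2 * rowHK lam 4 B t * rowUK lam A B t ^ 3) +
        270 * (rowHK lam 1 B t ^ 2 * rowHK lam 2 B t ^ 2 * rowUK lam A B t ^ 4) +
        120 * (rowHK lam 1 B t ^ 3 * rowHK lam 3 B t * rowUK lam A B t ^ 4) +
        360 * (rowHK lam 1 B t ^ 4 * rowHK lam 2 B t * rowUK lam A B t ^ 5) +
        120 * (rowHK lam 1 B t ^ 6 * rowUK lam A B t ^ 6) := by
    funext t; unfold rowPsiK5; ring
  rw [hfun]
  refine h.congr_deriv ?_
  unfold rowPsiK6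
  simp only [Pi.mul_apply, Pi.pow_apply]
  push_cast
  field_simp
  ring

/-- `d/dx ψ₆ = ψ₇/x`. [this file's lemma] -/
theorem hasDerivAt_rowPsiK6 {x : ℝ} (hx : x ≠ 0) (hF : A - ∑ l, B l * x ^ (lam l) ≠ 0) :
    HasDerivAt (rowPsiK6 lam A B) (rowPsiK7 lam A B x / x) x := by
  have hH1 := hasDerivAt_rowHK lam B 1 hx
  have hH2 := hasDerivAt_rowHK lam B 2 hx
  have hH3 := hasDerivAt_rowHK lam B 3 hx
  have hH4 := hasDerivAt_rowHK lam B 4 hx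
  have hH5 := hasDerivAt_rowHK lam B 5 hx
  have hH6 := hasDerivAt_rowHK lam B 6 hx
  have hH7 := hasDerivAt_rowHK lam B 7 hx
  have hH8 := hasDerivAt_rowHK lam B 8 hx
  have hu := hasDerivAt_rowUK lam A B hx hF
  have h := ((((((((((((((((hH7.mul hu).const_mul (1 : ℝ)).add (((hH3.mul hH4).mul (hu.pow 2)).const_mul (35 : ℝ))).add (((hH2.mul hH5).mul (hu.pow 2)).const_mul (21 : ℝ))).add (((hH1.mul hH6).mul (hu.pow 2)).const_mul (7 : ℝ))).add ((((hH2.pow 2).mul hH3).mul (hu.pow 3)).const_mul (210 : ℝ))).add (((hH1.mul (hH3.pow 2)).mul (hu.pow 3)).const_mul (140 : ℝ))).add ((((hH1.mul hH2).mul hH4).mul (hu.pow 3)).const_mul (210 : ℝ))).add ((((hH1.pow 2).mul hH5).mul (hu.pow 3)).const_mul (42 : ℝ))).add (((hH1.mul (hH2.pow 3)).mul (hu.pow 4)).const_mul (630 : ℝ))).add (((((hH1.pow 2).mul hH2).mul hH3).mul (hu.pow 4)).const_mul (1260 : ℝ))).add ((((hH1.pow 3).mul hH4).mul (hu.pow 4)).const_mul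 (210 : ℝ))).add ((((hH1.pow 3).mul (hH2.pow 2)).mul (hu.pow 5)).const_mul (2520 : ℝ))).add ((((hH1.pow 4).mul hH3).mul (hu.pow 5)).const_mul (840 : ℝ))).add ((((hH1.pow 5).mul hH2).mul (hu.pow 6)).const_mul (2520 : ℝ))).add (((hH1.pow 7).mul (hu.pow 7)).const_mul (720 : ℝ)))
  have hfun : rowPsiK6 lam A B = fun t =>
      1 * (rowHK lam 7 B t * rowUK lam A B t) +
        35 * (rowHK lam 3 B t * rowHK lam 4 B t * rowUK lam A B t ^ 2) +
        21 * (rowHK lam 2 B t * rowHK lam 5 B t * rowUK lam A B t ^ 2) +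
        7 * (rowHK lam 1 B t * rowHK lam 6 B t * rowUK lam A B t ^ 2) +
        210 * (rowHK lam 2 B t ^ 2 * rowHK lam 3 B t * rowUK lam A B t ^ 3) +
        140 * (rowHK lam 1 B t * rowHK lam 3 B t ^ 2 * rowUK lam A B t ^ 3) +
        210 * (rowHK lam 1 B t * rowHK lam 2 B t * rowHK lam 4 B t * rowUK lam A B t ^ 3) +
        42 * (rowHK lam 1 B t ^ 2 * rowHK lam 5 B t * rowUK lam A B t ^ 3) +
        630 * (rowHK lam 1 B t * rowHK lam 2 B t ^ 3 * rowUK lam A B t ^ 4) +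
        1260 * (rowHK lam 1 B t ^ 2 * rowHK lam 2 B t * rowHK lam 3 B t * rowUK lam A B t ^ 4) +
        210 * (rowHK lam 1 B t ^ 3 * rowHK lam 4 B t * rowUK lam A B t ^ 4) +
        2520 * (rowHK lam 1 B t ^ 3 * rowHK lam 2 B t ^ 2 * rowUK lam A B t ^ 5) +
        840 * (rowHK lam 1 B t ^ 4 * rowHK lam 3 B t * rowUK lam A B t ^ 5) +
        2520 * (rowHK lam 1 B t ^ 5 * rowHK lam 2 B t * rowUK lam A B t ^ 6) +
        720 * (rowHK lam 1 B t ^ 7 * rowUK lam A B t ^ 7) := by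
    funext t; unfold rowPsiK6; ring
  rw [hfun]
  refine h.congr_deriv ?_
  unfold rowPsiK7
  simp only [Pi.mul_apply, Pi.pow_apply]
  push_cast
  field_simp
  ring

end ProductPlusOne

end Summit.ValiantsHypothesis.ValiantsHypothesis.Theorems.LacunarySymmetroidMatrixDescartes
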